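import Summits.Ventures.HSemireg.WedgeHankelSubstitution
import Summits.Ventures.HSemireg.WedgeHankelCoSiegelClasses
import Summits.Ventures.HSemireg.WedgeHankelSiegelIdealStable

/-!
# Venture HSemireg — THE GENERAL LINEAR SUBSTITUTION (2): the Siegel vectors scale by the DETERMINANT, every substitution maps `SI_k` into `SI_k`, and for `αδ − βγ ≠ 0`
# the induced automorphism transports kernels and images of every class — EVERY INVERTIBLE SUBSTITUTION PRESERVES EVERY HANKEL RANK

HONEST FRAMING. Part of the Lean index of the computation cell `pub-hsemireg` (seat p10 gen 18, Sunday typer «UNIFORM-IN-n»).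
Finite-dimensional EXTERIOR ALGEBRA over a field ONLY: no variety, no cohomology theory, no sheaf, no Ext group, no semiregularity map;
nothing here says that HC / HC_CM / HC_AV holds; no Literature fact is declared or used.  Custodian versions as in `WedgeHankelSiegelIdeal` (1/3) and `WedgeHankelFrameChange`;
the dictionary (a linear substitution of the frame `(x_a, y_a) ↦ (αx_a + βy_a, γx_a + δy_a)`; the `GL₂`-action on the moments of a binary form of degree `n` preserves the ranks of its
catalecticants) is QUOTED, never asserted.

WHAT IS IN THE TREE.  F9 `linearIndependent_w_spike`, gen 11 `w_eq_sum_spikes`; H1 `WedgeHankelSubstitution` (this seat): `Sb α β γ δ := ExteriorAlgebra.map (sbLin α β γ δ)`, the moment transform `sbSeq`, the one theorem `Sb_w`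
(`Sb (w_m q) = w_m (sbSeq m q)`), the generators as instances, `Sb_comp` / `sbLin_comp` / `sbLin_one` / `linearMap_ext_xy`; E5 `Φs_sv` / `map_Φs_siegelIdeal` (the shear fixes the
Siegel vectors), `mul_sgen_mem_siegelIdeal`; E7 `Kr_mapEquiv` / `V_mapEquiv`; THEOREM H as `finrank_Kr_w_add_rank`; E6/E7/E12 `rank_hankel1_expMul` / `_rev` / `_scaleSeq`.
THIS FILE (namespace `Summit.Ventures.HSemireg.Wedge.HankelFrameChange` continued):
* §124 **`Sb_sv`: `Sb α β γ δ (s_{ab}) = (αδ − βγ)·s_{ab}`** — the symmetric 2-vectors are DETERMINANT-eigenvectors of every substitution (the `xx`/`yy` terms cancel by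
  anticommutativity); `map_Sb_exteriorPower_le` (`Sb(⋀^k) ≤ ⋀^k`), **`map_Sb_siegelIdeal_le`: `Sb(SI_k) ≤ SI_k` for EVERY substitution** (singular ones included).
* §125 `αδ − βγ ≠ 0`: the linear equivalence `sbEquiv` of the generators (inverse = the adjugate substitution over the determinant), the automorphism **`SbE h := mapEquiv (sbEquiv h)`**
  (`SbE_apply`: it is `Sb α β γ δ` on elements), **`map_SbE_siegelIdeal`: `SbE(SI_k) = SI_k`**, **`Kr_w_sbSeq`** / **`V_w_sbSeq`**: `Kr / V(univ, w_n(sbSeq α β γ δ n q), k) = SbE (Kr / V(univ, w_n(q), k))`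
  for every `q`, `k`, and **`rank_hankel1_sbSeq`: `rank H_k(sbSeq α β γ δ n q) = rank H_k(q)`** for every field, `n`, `k`, `q` — E6 `rank_hankel1_expMul`, E7 `rank_hankel1_rev`, E12
  `rank_hankel1_scaleSeq` in ONE statement (THEOREM H on both sides); `Kr_w_sbSeq_eq_siegelIdeal` (a kernel equal to `SI_k` stays `SI_k`).
* §125′ THE RIGHT ACTION ON COEFFICIENT WINDOWS: **`w_eq_w_iff`** (th-7's class determines its window: `w_n(q) = w_n(q′) ↔ q = q′` on `[0,n]`; F9's independence of the spike classes +
  gen 11's `w_eq_sum_spikes`), hence the SEQUENCE identities behind `Sb_comp`: **`sbSeq_comp_apply`** (`sbSeq (g·g′) n q = sbSeq g′ n (sbSeq g n q)` on `[0,n]` — the moment transform is a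
  right action of the matrix monoid), `sbSeq_congr`, `sbSeq_one_apply`, `sbSeq_inv_apply` (adjugate over determinant undoes `sbSeq g`), `rev_sbSeq_rev_apply` (`W·g·W = [[δ,γ],[β,α]]`).
NOT typed here: the action on NODE classes / divisors (the Möbius map on the nodes — next leaf); the closed double-binomial form of `sbSeq` (the dictionary's moments of
`(αu+γv)^{n−j}(βu+δv)^j`; only the recursion is typed); anything Ext-side.  Class side only; new names only.
-/

open Module

namespace Summit.Ventures.HSemireg.Wedge.HankelFrameChange

open Summit.Ventures.HSemireg.Wedge Summit.Ventures.HSemireg.Wedge.Kunneth Summit.Ventures.HSemireg.Wedge.Hankel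
  Summit.Ventures.HSemireg.Wedge.BasisFree Summit.Ventures.HSemireg.Wedge.HankelSiegel Summit.Ventures.HSemireg.Wedge.HankelSiegelIdeal
  Summit.Ventures.HSemireg.Wedge.KunnethKernel Summit.Ventures.HSemireg.Wedge.HankelRankOne

variable (K : Type*) [Field K] {n : ℕ}

/-! ## §124. The Siegel vectors are determinant-eigenvectors; every substitution preserves the Siegel ideal -/

/-- **`Sb (s_{ab}) = (αδ − βγ)·s_{ab}`**: the symmetric 2-vectors scale by the DETERMINANT (`(αx_a+βy_a)(γx_b+δy_b) + (αx_b+βy_b)(γx_a+δy_a)`: the `xx` and `yy` terms cancel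
by anticommutativity, the mixed terms give `αδ·s_{ab} − βγ·s_{ab}`). -/
theorem Sb_sv (α β γ δ : K) (a c : ℕ) : Sb K α β γ δ (sv K (n := n) a c) = (α * δ - β * γ) • sv K a c := by
  rw [sv]
  by_cases hac : a = c
  · subst hac
    rw [if_pos rfl, add_zero, map_mul, Sb_X', Sb_Y']
    simp only [add_mul, mul_add, smul_mul_assoc, mul_smul_comm, smul_smul, mul_self_of_gen (X_gen K a), mul_self_of_gen (Y_gen K a), smul_zero, zero_add, add_zero]
    rw [anticomm_of_gen (Y_gen K a) (X_gen K a)]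
    module
  · rw [if_neg hac, map_add, map_mul, map_mul, Sb_X', Sb_Y', Sb_X', Sb_Y']
    simp only [add_mul, mul_add, smul_mul_assoc, mul_smul_comm]
    rw [anticomm_of_gen (X_gen K c) (X_gen K a), anticomm_of_gen (Y_gen K c) (Y_gen K a), anticomm_of_gen (Y_gen K a) (X_gen K c),
      anticomm_of_gen (Y_gen K c) (X_gen K a)]
    module

/-- on the Siegel generators: `Sb (sgen p) = (αδ − βγ)·sgen p`. -/
lemma Sb_sgen (α β γ δ : K) (p : SIdx n) : Sb K α β γ δ (sgen K p) = (α * δ - β * γ) • sgen K p := Sb_sv K α β γ δ _ _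

/-- **every substitution maps `⋀^k` into `⋀^k`** (`ιMulti v ↦ ιMulti (g ∘ v)`). -/
theorem map_Sb_exteriorPower_le (α β γ δ : K) (k : ℕ) : (⋀[K]^k (In n → K)).map (Sb K (n := n) α β γ δ).toLinearMap ≤ ⋀[K]^k (In n → K) := by
  rw [← ExteriorAlgebra.ιMulti_span_fixedDegree K k, Submodule.map_span, Submodule.span_le]
  rintro _ ⟨_, ⟨v, rfl⟩, rfl⟩
  rw [SetLike.mem_coe, AlgHom.toLinearMap_apply, Sb, ExteriorAlgebra.map_apply_ιMulti]
  exact Submodule.subset_span ⟨_, rfl⟩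

/-- membership form. -/
lemma Sb_mem_exteriorPower (α β γ δ : K) {k : ℕ} {θ : HT K (In n)} (hθ : θ ∈ ⋀[K]^k (In n → K)) : Sb K α β γ δ θ ∈ ⋀[K]^k (In n → K) :=
  map_Sb_exteriorPower_le K α β γ δ k ⟨θ, hθ, rfl⟩

/-- **EVERY substitution maps the Siegel ideal into itself: `Sb (SI_k) ≤ SI_k`** (singular ones included). -/
theorem map_Sb_siegelIdeal_le (α β γ δ : K) (k : ℕ) : (siegelIdeal K n k).map (Sb K (n := n) α β γ δ).toLinearMap ≤ siegelIdeal K n k := by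
  rw [siegelIdeal, Submodule.map_span, Submodule.span_le]
  rintro _ ⟨_, ⟨p, rfl⟩, rfl⟩
  obtain ⟨⟨t, ht⟩, s⟩ := p
  subst ht
  rw [SetLike.mem_coe, AlgHom.toLinearMap_apply, igen, map_mul, Sb_sgen, mul_smul_comm]
  refine Submodule.smul_mem _ _ (mul_sgen_mem_siegelIdeal K ?_ s)
  have hB : B K (In n) t ∈ ⋀[K]^t.card (In n → K) := by
    rw [exteriorPower_eq_Hom_univ]; exact B_mem_Hom K (Finset.subset_univ t) rfl
  exact Sb_mem_exteriorPower K α β γ δ hB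

/-! ## §125. Invertible substitutions: the automorphism, transport of kernels / images, invariance of every Hankel rank -/

/-- **the INVERTIBLE substitution as a linear equivalence of the generators** (`αδ − βγ ≠ 0`; inverse = the adjugate substitution divided by the determinant). -/
noncomputable def sbEquiv {α β γ δ : K} (h : α * δ - β * γ ≠ 0) : (In n → K) ≃ₗ[K] (In n → K) :=
  LinearEquiv.ofLinear (sbLin K (n := n) α β γ δ)
    (sbLin K (δ * (α * δ - β * γ)⁻¹) (-β * (α * δ - β * γ)⁻¹) (-γ * (α * δ - β * γ)⁻¹) (α * (α * δ - β * γ)⁻¹))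
    (by
      have hd : (α * δ - β * γ) * (α * δ - β * γ)⁻¹ = 1 := mul_inv_cancel₀ h
      rw [sbLin_comp]
      have e1 : δ * (α * δ - β * γ)⁻¹ * α + -β * (α * δ - β * γ)⁻¹ * γ = 1 := by linear_combination hd
      have e2 : δ * (α * δ - β * γ)⁻¹ * β + -β * (α * δ - β * γ)⁻¹ * δ = 0 := by ring
      have e3 : -γ * (α * δ - β * γ)⁻¹ * α + α * (α * δ - β * γ)⁻¹ * γ = 0 := by ring
      have e4 : -γ * (α * δ - β * γ)⁻¹ * β + α * (α * δ - β * γ)⁻¹ * δ = 1 := by linear_combination hd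
      rw [e1, e2, e3, e4, sbLin_one])
    (by
      have hd : (α * δ - β * γ) * (α * δ - β * γ)⁻¹ = 1 := mul_inv_cancel₀ h
      rw [sbLin_comp]
      have e1 : α * (δ * (α * δ - β * γ)⁻¹) + β * (-γ * (α * δ - β * γ)⁻¹) = 1 := by linear_combination hd
      have e2 : α * (-β * (α * δ - β * γ)⁻¹) + β * (α * (α * δ - β * γ)⁻¹) = 0 := by ring
      have e3 : γ * (δ * (α * δ - β * γ)⁻¹) + δ * (-γ * (α * δ - β * γ)⁻¹) = 0 := by ring
      have e4 : γ * (-β * (α * δ - β * γ)⁻¹) + δ * (α * (α * δ - β * γ)⁻¹) = 1 := by linear_combination hd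
      rw [e1, e2, e3, e4, sbLin_one])

/-- **THE SUBSTITUTION AUTOMORPHISM `SbE h := mapEquiv (sbEquiv h)`** of `⋀(K^{2n})` for `αδ − βγ ≠ 0`. -/
noncomputable def SbE {α β γ δ : K} (h : α * δ - β * γ ≠ 0) : HT K (In n) ≃ₐ[K] HT K (In n) := mapEquiv K (sbEquiv K (n := n) h)

/-- `SbE h` is `Sb α β γ δ` on elements. -/
@[simp] theorem SbE_apply {α β γ δ : K} (h : α * δ - β * γ ≠ 0) (f : HT K (In n)) : SbE K (n := n) h f = Sb K α β γ δ f := rfl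

/-- … and as linear maps. -/
lemma SbE_toLinearMap {α β γ δ : K} (h : α * δ - β * γ ≠ 0) : (SbE K (n := n) h).toLinearMap = (Sb K (n := n) α β γ δ).toLinearMap :=
  LinearMap.ext fun _ => rfl

/-- **an invertible substitution maps the Siegel ideal ONTO itself: `SbE h (SI_k) = SI_k`.** -/
theorem map_SbE_siegelIdeal {α β γ δ : K} (h : α * δ - β * γ ≠ 0) (k : ℕ) :
    (siegelIdeal K n k).map (SbE K (n := n) h).toLinearMap = siegelIdeal K n k :=
  Submodule.eq_of_le_of_finrank_eq (by rw [SbE_toLinearMap]; exact map_Sb_siegelIdeal_le K α β γ δ k) ((SbE K (n := n) h).toLinearEquiv.finrank_map_eq _)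

/-- **KERNELS ARE TRANSPORTED: `Kr(univ, w_n(sbSeq α β γ δ n q), k) = SbE h (Kr(univ, w_n(q), k))`** for every `q`, `k` (`αδ − βγ ≠ 0`). -/
theorem Kr_w_sbSeq {α β γ δ : K} (h : α * δ - β * γ ≠ 0) (q : ℕ → K) (k : ℕ) :
    Kr K Finset.univ (w K n n (sbSeq K α β γ δ n q)) k = (Kr K Finset.univ (w K n n q) k).map (SbE K (n := n) h).toLinearMap := by
  rw [← Sb_w K α β γ δ le_rfl, ← SbE_apply K h]
  exact Kr_mapEquiv K _ _ k

/-- **IMAGES ARE TRANSPORTED: `V(univ, w_n(sbSeq α β γ δ n q), k) = SbE h (V(univ, w_n(q), k))`.** -/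
theorem V_w_sbSeq {α β γ δ : K} (h : α * δ - β * γ ≠ 0) (q : ℕ → K) (k : ℕ) :
    V K (In n) Finset.univ (w K n n (sbSeq K α β γ δ n q)) k = (V K (In n) Finset.univ (w K n n q) k).map (SbE K (n := n) h).toLinearMap := by
  rw [← Sb_w K α β γ δ le_rfl, ← SbE_apply K h]
  exact V_mapEquiv K _ _ k

/-- hence the kernel numbers agree in every degree. -/
theorem finrank_Kr_w_sbSeq {α β γ δ : K} (h : α * δ - β * γ ≠ 0) (q : ℕ → K) (k : ℕ) :
    finrank K (Kr K Finset.univ (w K n n (sbSeq K α β γ δ n q)) k) = finrank K (Kr K Finset.univ (w K n n q) k) := by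
  rw [Kr_w_sbSeq K h]; exact (SbE K (n := n) h).toLinearEquiv.finrank_map_eq _

/-- **EVERY INVERTIBLE SUBSTITUTION PRESERVES EVERY HANKEL RANK: `rank H_k(sbSeq α β γ δ n q) = rank H_k(q)`** for every field, `n`, `k`, `q` and `αδ − βγ ≠ 0` — E6
`rank_hankel1_expMul`, E7 `rank_hankel1_rev`, E12 `rank_hankel1_scaleSeq` at once (THEOREM H on both sides; dictionary: the `GL₂`-action on binary forms preserves catalecticant ranks). -/
theorem rank_hankel1_sbSeq {α β γ δ : K} (h : α * δ - β * γ ≠ 0) (k : ℕ) (q : ℕ → K) :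
    (hankel1 K n k (sbSeq K α β γ δ n q)).rank = (hankel1 K n k q).rank := by
  by_cases hk : k ≤ n
  · have h1 := finrank_Kr_w_add_rank K (n := n) k q
    have h2 := finrank_Kr_w_add_rank K (n := n) k (sbSeq K α β γ δ n q)
    rw [finrank_Kr_w_sbSeq K h] at h2
    exact Nat.eq_of_mul_eq_mul_left (Nat.choose_pos hk) (by omega)
  · rw [rank_hankel1_eq_zero_of_lt K (by omega), rank_hankel1_eq_zero_of_lt K (by omega)]

/-- **… and an invertible substitution FIXES the kernel exactly when it fixes it as a set; in particular the kernel of a class in the Siegel range is invariant**: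
if `Kr(univ, w_n(q), k) = SI_k` then `Kr(univ, w_n(sbSeq n q), k) = SI_k` as well. -/
theorem Kr_w_sbSeq_eq_siegelIdeal {α β γ δ : K} (h : α * δ - β * γ ≠ 0) {q : ℕ → K} {k : ℕ} (hq : Kr K Finset.univ (w K n n q) k = siegelIdeal K n k) :
    Kr K Finset.univ (w K n n (sbSeq K α β γ δ n q)) k = siegelIdeal K n k := by
  rw [Kr_w_sbSeq K h, hq, map_SbE_siegelIdeal]

/-! ## §125′. The right action on coefficient windows -/

/-- **th-7's CLASS DETERMINES ITS WINDOW: `w_n(q) = w_n(q′) ↔ q_j = q′_j` for all `j ≤ n`** (gen 11's `w_eq_sum_spikes` + F9's `linearIndependent_w_spike`). -/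
theorem w_eq_w_iff (q q' : ℕ → K) : w K n n q = w K n n q' ↔ ∀ j ≤ n, q j = q' j := by
  refine ⟨fun h j hj => ?_, fun h => w_eq_of_agree K n h⟩
  have hs : ∑ p : Fin (n + 1), (q p - q' p) • w K n n (fun i => if i = (p : ℕ) then (1 : K) else 0) = 0 := by
    rw [← Finset.sum_range (fun p => (q p - q' p) • w K n n (fun i => if i = p then (1 : K) else 0))]
    simp only [sub_smul, Finset.sum_sub_distrib, ← w_eq_sum_spikes, h, sub_self]
  have h0 := linearIndependent_iff'.mp (KernelDuality.linearIndependent_w_spike K (n := n)) Finset.univ (fun p => q p - q' p) hs ⟨j, by omega⟩ (Finset.mem_univ _)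
  exact sub_eq_zero.mp h0

/-- `sbSeq … n` reads only the window: `q = q′` on `[0,n]` ⇒ `sbSeq α β γ δ n q = sbSeq α β γ δ n q′` on `[0,n]`. -/
theorem sbSeq_congr (α β γ δ : K) {q q' : ℕ → K} (h : ∀ j ≤ n, q j = q' j) {j : ℕ} (hj : j ≤ n) : sbSeq K α β γ δ n q j = sbSeq K α β γ δ n q' j := by
  have hw : w K n n (sbSeq K α β γ δ n q) = w K n n (sbSeq K α β γ δ n q') := by
    rw [← Sb_w K α β γ δ le_rfl, ← Sb_w K α β γ δ le_rfl, w_eq_of_agree K n h]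
  exact (w_eq_w_iff K _ _).mp hw j hj

/-- **THE MOMENT TRANSFORM IS A RIGHT ACTION OF THE MATRIX MONOID ON THE WINDOWS `[0, n]`**: `sbSeq (g·g′) n q = sbSeq g′ n (sbSeq g n q)` on `[0, n]` — the sequence identity
behind `Sb_comp` (`w_eq_w_iff`). -/
theorem sbSeq_comp_apply (α β γ δ α' β' γ' δ' : K) (q : ℕ → K) {j : ℕ} (hj : j ≤ n) :
    sbSeq K (α * α' + β * γ') (α * β' + β * δ') (γ * α' + δ * γ') (γ * β' + δ * δ') n q j = sbSeq K α' β' γ' δ' n (sbSeq K α β γ δ n q) j := by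
  have h : w K n n (sbSeq K (α * α' + β * γ') (α * β' + β * δ') (γ * α' + δ * γ') (γ * β' + δ * δ') n q) =
      w K n n (sbSeq K α' β' γ' δ' n (sbSeq K α β γ δ n q)) := by
    rw [← Sb_w K _ _ _ _ le_rfl, ← Sb_Sb, Sb_w K α β γ δ le_rfl, Sb_w K α' β' γ' δ' le_rfl]
  exact (w_eq_w_iff K _ _).mp h j hj

/-- the identity matrix acts trivially: `sbSeq 1 0 0 1 n q j = q_j` (`j ≤ n`). -/
theorem sbSeq_one_apply (q : ℕ → K) {j : ℕ} (hj : j ≤ n) : sbSeq K 1 0 0 1 n q j = q j := by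
  rw [sbSeq_scale K 1 n q hj]
  simp only [scaleSeq, one_pow, one_mul]

/-- **the adjugate over the determinant undoes the transform on the window** (`αδ − βγ ≠ 0`, `j ≤ n`). -/
theorem sbSeq_inv_apply {α β γ δ : K} (h : α * δ - β * γ ≠ 0) (q : ℕ → K) {j : ℕ} (hj : j ≤ n) :
    sbSeq K (δ * (α * δ - β * γ)⁻¹) (-β * (α * δ - β * γ)⁻¹) (-γ * (α * δ - β * γ)⁻¹) (α * (α * δ - β * γ)⁻¹) n (sbSeq K α β γ δ n q) j = q j := by
  have hd : (α * δ - β * γ) * (α * δ - β * γ)⁻¹ = 1 := mul_inv_cancel₀ h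
  have e1 : α * (δ * (α * δ - β * γ)⁻¹) + β * (-γ * (α * δ - β * γ)⁻¹) = 1 := by linear_combination hd
  have e2 : α * (-β * (α * δ - β * γ)⁻¹) + β * (α * (α * δ - β * γ)⁻¹) = 0 := by ring
  have e3 : γ * (δ * (α * δ - β * γ)⁻¹) + δ * (-γ * (α * δ - β * γ)⁻¹) = 0 := by ring
  have e4 : γ * (-β * (α * δ - β * γ)⁻¹) + δ * (α * (α * δ - β * γ)⁻¹) = 1 := by linear_combination hd
  rw [← sbSeq_comp_apply K _ _ _ _ _ _ _ _ q hj, e1, e2, e3, e4, sbSeq_one_apply K q hj]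

/-- conjugation by the swap: `rev_n (sbSeq α β γ δ n (rev_n q)) = sbSeq δ γ β α n q` on `[0, n]` (`W·g·W = [[δ,γ],[β,α]]`). -/
theorem rev_sbSeq_rev_apply (α β γ δ : K) (q : ℕ → K) {j : ℕ} (hj : j ≤ n) : rev K n (sbSeq K α β γ δ n (rev K n q)) j = sbSeq K δ γ β α n q j := by
  have e : ∀ i ≤ n, sbSeq K α β γ δ n (rev K n q) i = sbSeq K (0 * α + 1 * γ) (0 * β + 1 * δ) (1 * α + 0 * γ) (1 * β + 0 * δ) n q i := fun i hi => by
    rw [sbSeq_comp_apply K 0 1 1 0 α β γ δ q hi]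
    exact sbSeq_congr K α β γ δ (fun l _ => (sbSeq_swap K n q l).symm) hi
  rw [← sbSeq_swap K n _ j, sbSeq_congr K 0 1 1 0 e hj, ← sbSeq_comp_apply K _ _ _ _ 0 1 1 0 q hj]
  congr 1 <;> ring

end Summit.Ventures.HSemireg.Wedge.HankelFrameChange
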